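import Summits.CriticalPhenomena.PercolationContinuityZ3.Theorems.PercNearOneGluingNoHeavyLowerTailSahiOneStepFreeBlockReducePrelim
import Summits.CriticalPhenomena.PercolationContinuityZ3.Theorems.PercNearOneGluingNoHeavyLowerTailSahiOneStepUniformShiftMeasure
import HarnessLib

/-!
# One-step scheme: the COSTLY-REGION REDUCTION of the partner, part 2/2 — after it, the partner does not depend on the pivot

Support file (prover prim-ineq-prove-3 gen 53; `--supports stmt-CriticalPhenomena-4575`; memo
`run/shared/lean/prim/prim-ineq-prove-3/PROOF-G53-FREE-BLOCK.md` §3).  No definitions, no named facts, no sorries, no `native_decide`.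

Part 1 (`…FreeBlockReducePrelim`): the costly region `G = A ∩ {g ≤ #(K∩ω)}` (`K = insert e F`), the hull `B♯` over `G` and the removal
`B₂ = ↑(B♯ ∖ G)` do not increase `n(A,·)` (any density).  Here:
* §4 trades: `G` is `e`-dominant when `A` is (`dominant_costly`); `e`-domination of `B` passes to `B♯` (`dominated_hgen_region`) and to `B₂`
  (`dominated_lift`); and **`lift_free`**: if `A` is `e`-DOMINANT and `B` is `e`-DOMINATED over `F` (e.g. after the opposite compressions of
  `…UniformShiftMeasure`), then `B₂` DOES NOT DEPEND ON `e` — a pattern `ω ∌ e` of minimal level with `ω + e ∈ B₂ ∌ ω` has `ω + e` minimal in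
  `B₂`, so `ω + e ∈ B♯ ∖ G`, while `ω` is maximal outside `B₂` (by `e`-domination), which forces `ω ∈ G`; impossible since `G` is increasing.
* §5 **`exists_free_reduct`** (the package: an increasing `insert e F`-determined `e`-FREE `B₂` with `n(A,B₂) ≤ n(A,B)`, for the slot
  `Th_{t+1}(insert e S')`, `F ⊆ S'`, ANY density — the costly level `g` is the first `k` with `φ_k·μ(L∩Aᶜ) ≤ ℓ·μAᶜ`) and
  **`drift_nonpos_of_free`**: the ball-conditioned drift of an `e`-free partner is `≤ 0` (ball monotonicity `real_inter_ball_mul_le`, any density).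
With MONO-A (`drift_nonneg_of_dominant`, any density) this replaces MONO-B + `H`-generation in gen 21's induction and closes
`…SahiOneStepFreeBlock`: `(2′)` for `Th_t(F ∪ E)` with the density constant on `F` and ARBITRARY on the free block `E`.
-/

noncomputable section

namespace Summit.CriticalPhenomena.PercolationContinuityZ3.Theorems

namespace SahiOneStep

open MeasureTheory Finset
open Literature.Probability.Percolation (DeterminedBy determinedBy_iff)
open Literature.Probability.LatticeModels (prodBernoulli prodBernoulli_harris prodBernoulli_real_inter_of_determinedBy_disjoint)
open Literature.Probability.Percolation.DecisionTree (ind)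
open SahiE3Sections (determinedBy_section_insert determinedBy_section_sdiff)
open scoped Classical

variable {ι : Type*} [Fintype ι]

/-! ## §4 Trades: the reduced partner is `e`-dominated, and then does not depend on `e` -/

section free

variable {F : Finset ι} {e : ι} {g : ℕ} {A B : Set (Set ι)}

omit [Fintype ι] in
/-- Undoing a trade: `((z ∖ {j}) ∪ {e}) ∖ {e} ∪ {j} = z` for `j ∈ z ∌ e`. [folklore] -/
theorem trade_untrade {z : Set ι} {e j : ι} (hjz : j ∈ z) (hez : e ∉ z) : ((z \ {j}) ∪ {e}) \ {e} ∪ {j} = z := by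
  ext x
  simp only [Set.mem_union, Set.mem_sdiff, Set.mem_singleton_iff]
  constructor
  · rintro (⟨⟨hx, _⟩ | hx, hxe⟩ | rfl)
    · exact hx
    · exact absurd hx hxe
    · exact hjz
  · intro hx
    by_cases hxj : x = j
    · exact Or.inr hxj
    · exact Or.inl ⟨Or.inl ⟨hx, hxj⟩, fun hxe => hez (hxe ▸ hx)⟩

omit [Fintype ι] in
/-- The costly region of an `e`-dominant `A` is `e`-dominant (a trade inside `insert e F` keeps the level). [this work] -/
theorem dominant_costly (hdomA : ∀ j ∈ F, ∀ ω ∈ A, e ∉ ω → j ∈ ω → (ω \ {j}) ∪ {e} ∈ A) :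
    ∀ j ∈ F, ∀ ω ∈ A ∩ {ω : Set ι | g ≤ ((insert e F).filter (· ∈ ω)).card}, e ∉ ω → j ∈ ω →
      (ω \ {j}) ∪ {e} ∈ A ∩ {ω : Set ι | g ≤ ((insert e F).filter (· ∈ ω)).card} := by
  intro j hj ω hω heω hjω
  refine ⟨hdomA j hj ω hω.1 heω hjω, ?_⟩
  have h := hω.2
  simp only [Set.mem_setOf_eq] at h ⊢
  rw [Finset.filter_congr_decidable (insert e F) (· ∈ (ω \ {j}) ∪ {e}) _,
    card_filter_trade (Finset.mem_insert_of_mem hj) (Finset.mem_insert_self e F) hjω heω]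
  rwa [Finset.filter_congr_decidable (insert e F) (· ∈ ω) _] at h

omit [Fintype ι] in
/-- `e`-domination of `B` passes to its hull over an `e`-dominant region `G` (cf. `dominated_hgen`). [this work] -/
theorem dominated_hgen_region {G B : Set (Set ι)} {e j : ι} (hej : e ≠ j)
    (hGdom : ∀ ω ∈ G, e ∉ ω → j ∈ ω → (ω \ {j}) ∪ {e} ∈ G)
    (hdom : ∀ ω ∈ B, e ∈ ω → j ∉ ω → (ω \ {e}) ∪ {j} ∈ B) :
    ∀ ω ∈ {ω : Set ι | ∀ ω' : Set ι, ω ⊆ ω' → ω' ∈ G → ω' ∈ B},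
      e ∈ ω → j ∉ ω → (ω \ {e}) ∪ {j} ∈ {ω : Set ι | ∀ ω' : Set ι, ω ⊆ ω' → ω' ∈ G → ω' ∈ B} := by
  intro ω hω _heω hjω z hz hzG
  have hjz : j ∈ z := hz (Or.inr rfl)
  by_cases hez : e ∈ z
  · refine hω z (fun x hx => ?_) hzG
    by_cases hxe : x = e
    · exact hxe ▸ hez
    · exact hz (Or.inl ⟨hx, hxe⟩)
  · have hz₀ : ω ⊆ (z \ {j}) ∪ {e} := by
      intro x hx
      by_cases hxe : x = e
      · exact Or.inr hxe
      · have hxz : x ∈ z := hz (Or.inl ⟨hx, hxe⟩)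
        exact Or.inl ⟨hxz, fun hxj => hjω (hxj ▸ hx)⟩
    have hz₀B := hω _ hz₀ (hGdom z hzG hez hjz)
    have h := hdom _ hz₀B (Or.inr rfl) (fun h => h.elim (fun h => h.2 rfl) (fun h => hej h.symm))
    rw [trade_untrade hjz hez] at h
    exact h

omit [Fintype ι] in
/-- `e`-domination passes from an increasing `Bs` to the removal `↑(Bs ∖ G)` (`G` `e`-dominant). [this work] -/
theorem dominated_lift {G Bs : Set (Set ι)} {e j : ι} (hej : e ≠ j)
    (hGdom : ∀ ω ∈ G, e ∉ ω → j ∈ ω → (ω \ {j}) ∪ {e} ∈ G)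
    (hdom : ∀ ω ∈ Bs, e ∈ ω → j ∉ ω → (ω \ {e}) ∪ {j} ∈ Bs) :
    ∀ ω ∈ {ω : Set ι | ∃ ω' : Set ι, ω' ⊆ ω ∧ ω' ∈ Bs ∧ ω' ∉ G},
      e ∈ ω → j ∉ ω → (ω \ {e}) ∪ {j} ∈ {ω : Set ι | ∃ ω' : Set ι, ω' ⊆ ω ∧ ω' ∈ Bs ∧ ω' ∉ G} := by
  rintro ω ⟨ω', hsub, hBs', hG'⟩ _heω hjω
  have hjω' : j ∉ ω' := fun h => hjω (hsub h)
  by_cases heω' : e ∈ ω'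
  · refine ⟨(ω' \ {e}) ∪ {j}, ?_, hdom ω' hBs' heω' hjω', fun hG => hG' ?_⟩
    · rintro x (⟨hx1, hx2⟩ | hx)
      · exact Or.inl ⟨hsub hx1, hx2⟩
      · exact Or.inr hx
    · have h := hGdom _ hG (fun h => h.elim (fun h => h.2 rfl) (fun h => hej h)) (Or.inr rfl)
      rw [trade_untrade' hjω' heω'] at h
      exact h
  · refine ⟨ω', ?_, hBs', hG'⟩
    intro x hx
    exact Or.inl ⟨hsub hx, fun hxe => heω' (hxe ▸ hx)⟩
where
  /-- `((z ∖ {e}) ∪ {j}) ∖ {j} ∪ {e} = z` for `e ∈ z ∌ j` -/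
  trade_untrade' {z : Set ι} {e j : ι} (hjz : j ∉ z) (hez : e ∈ z) : ((z \ {e}) ∪ {j}) \ {j} ∪ {e} = z :=
    trade_untrade hez hjz

/-- **THE REDUCED PARTNER DOES NOT DEPEND ON THE PIVOT** (memo Lemma 4).  `K = insert e F`; `A` increasing, `K`-determined and
`e`-DOMINANT (`j ∈ ω ∌ e`, `ω ∈ A` ⟹ `ω − j + e ∈ A` for `j ∈ F`); `B` increasing, `K`-determined and `e`-DOMINATED; `G = A ∩ {g ≤ #(K∩ω)}`,
`B♯ = {ω | every ω' ⊇ ω in G lies in B}`, `B₂ = ↑(B♯ ∖ G)`.  Then `insert e ω ∈ B₂ → ω ∈ B₂` for every `ω ∌ e`.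
(A pattern `ω ∌ e` of minimal level with `ω + e ∈ B₂ ∌ ω` has `ω + e` minimal in `B₂`, so `ω + e ∈ B♯ ∖ G`; and `ω` is maximal outside `B₂`
(`e`-domination), which forces `ω ∈ G`; but `G` is increasing.) [this work] -/
theorem lift_free (heF : e ∉ F) (hA : IsUpperSet A) (hAK : DeterminedBy A (↑(insert e F) : Set ι))
    (hBK : DeterminedBy B (↑(insert e F) : Set ι))
    (hdomA : ∀ j ∈ F, ∀ ω ∈ A, e ∉ ω → j ∈ ω → (ω \ {j}) ∪ {e} ∈ A)
    (hdomB : ∀ j ∈ F, ∀ ω ∈ B, e ∈ ω → j ∉ ω → (ω \ {e}) ∪ {j} ∈ B) (g : ℕ) :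
    ∀ ω : Set ι, e ∉ ω →
      insert e ω ∈ {ω : Set ι | ∃ ω' : Set ι, ω' ⊆ ω ∧
          ω' ∈ {ω : Set ι | ∀ ω'' : Set ι, ω ⊆ ω'' → ω'' ∈ A ∩ {ω : Set ι | g ≤ ((insert e F).filter (· ∈ ω)).card} → ω'' ∈ B} ∧
          ω' ∉ A ∩ {ω : Set ι | g ≤ ((insert e F).filter (· ∈ ω)).card}} →
      ω ∈ {ω : Set ι | ∃ ω' : Set ι, ω' ⊆ ω ∧
          ω' ∈ {ω : Set ι | ∀ ω'' : Set ι, ω ⊆ ω'' → ω'' ∈ A ∩ {ω : Set ι | g ≤ ((insert e F).filter (· ∈ ω)).card} → ω'' ∈ B} ∧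
          ω' ∉ A ∩ {ω : Set ι | g ≤ ((insert e F).filter (· ∈ ω)).card}} := by
  set K : Finset ι := insert e F with hKdef
  set G : Set (Set ι) := A ∩ {ω : Set ι | g ≤ (K.filter (· ∈ ω)).card} with hGdef
  set Bs : Set (Set ι) := {ω : Set ι | ∀ ω'' : Set ι, ω ⊆ ω'' → ω'' ∈ G → ω'' ∈ B} with hBsdef
  set B₂ : Set (Set ι) := {ω : Set ι | ∃ ω' : Set ι, ω' ⊆ ω ∧ ω' ∈ Bs ∧ ω' ∉ G} with hB₂def
  have heK : e ∈ K := Finset.mem_insert_self e F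
  have hGup : IsUpperSet G := isUpperSet_costly hA K g
  have hGK : DeterminedBy G (↑K : Set ι) := determinedBy_costly hAK g
  have hBsup : IsUpperSet Bs := isUpperSet_hgen G B
  have hBsK : DeterminedBy Bs (↑K : Set ι) := determinedBy_hgen hGK hBK
  have hB₂up : IsUpperSet B₂ := isUpperSet_lift Bs G
  have hB₂Bs : B₂ ⊆ Bs := lift_subset hBsup
  have hGdom : ∀ j ∈ F, ∀ ω ∈ G, e ∉ ω → j ∈ ω → (ω \ {j}) ∪ {e} ∈ G := dominant_costly hdomA
  have hB₂dom : ∀ j ∈ F, ∀ ω ∈ B₂, e ∈ ω → j ∉ ω → (ω \ {e}) ∪ {j} ∈ B₂ := by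
    intro j hj
    have hej : e ≠ j := fun h => heF (h ▸ hj)
    exact dominated_lift hej (hGdom j hj) (dominated_hgen_region hej (hGdom j hj) (hdomB j hj))
  -- strong induction on the level of `ω`
  suffices key : ∀ n : ℕ, ∀ ω : Set ι, e ∉ ω → (K.filter (· ∈ ω)).card = n → insert e ω ∈ B₂ → ω ∈ B₂ from
    fun ω heω h => key _ ω heω rfl h
  intro n
  induction n using Nat.strong_induction_on with
  | _ n ih =>
  intro ω heω hn hins
  by_contra hω
  -- (a) no lower `F`-neighbour of `insert e ω` lies in `B₂`
  -- (the lower neighbour is a fresh variable `ω₁ = ω ∖ {j}`, so that the level expression keeps its shape)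
  have hlow : ∀ j ∈ F, j ∈ ω → ∀ ω₁ : Set ι, ω₁ = ω \ {j} → insert e ω₁ ∉ B₂ := by
    intro j hj hjω ω₁ hω₁ hmem
    have hjK : j ∈ K := Finset.mem_insert_of_mem hj
    have hsub₁ : ω₁ ⊆ ω := by rw [hω₁]; exact Set.sdiff_subset
    have hj₁ : j ∉ ω₁ := by rw [hω₁]; exact fun h => h.2 rfl
    have he₁ : e ∉ ω₁ := fun h => heω (hsub₁ h)
    have hlt : (K.filter (· ∈ ω₁)).card < n := by
      rw [← hn]
      apply Finset.card_lt_card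
      refine (Finset.ssubset_iff_of_subset fun x hx => ?_).2 ⟨j, Finset.mem_filter.2 ⟨hjK, hjω⟩, fun h => hj₁ (Finset.mem_filter.1 h).2⟩
      rw [Finset.mem_filter] at hx ⊢
      exact ⟨hx.1, hsub₁ hx.2⟩
    have h1 : ω₁ ∈ B₂ := ih _ hlt ω₁ he₁ rfl hmem
    exact hω (hB₂up hsub₁ h1)
  -- (b) the witness of `insert e ω ∈ B₂` is `insert e ω` itself: `insert e ω ∈ B♯ ∖ G`
  obtain ⟨ω', hsub, hBs', hG'⟩ := hins
  have heω' : e ∈ ω' := by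
    by_contra h
    refine hω ⟨ω', fun x hx => ?_, hBs', hG'⟩
    rcases (Set.mem_insert_iff.1 (hsub hx)) with rfl | hx'
    · exact absurd hx h
    · exact hx'
  have hFω' : ∀ j ∈ F, j ∈ ω → j ∈ ω' := by
    intro j hj hjω
    by_contra hjω'
    refine hlow j hj hjω (ω \ {j}) rfl ⟨ω', fun x hx => ?_, hBs', hG'⟩
    rcases (Set.mem_insert_iff.1 (hsub hx)) with rfl | hx'
    · exact Set.mem_insert _ _
    · exact Set.mem_insert_of_mem _ ⟨hx', fun hxj => hjω' (hxj ▸ hx)⟩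
  have hagree : insert e ω ∩ (↑K : Set ι) = ω' ∩ ↑K := by
    ext x
    simp only [Set.mem_inter_iff, Set.mem_insert_iff, Finset.mem_coe, hKdef, Finset.mem_insert]
    constructor
    · rintro ⟨rfl | hxω, hxK⟩
      · exact ⟨heω', hxK⟩
      · rcases hxK with rfl | hxF
        · exact ⟨heω', Or.inl rfl⟩
        · exact ⟨hFω' x hxF hxω, Or.inr hxF⟩
    · rintro ⟨hxω', hxK⟩
      refine ⟨?_, hxK⟩
      rcases Set.mem_insert_iff.1 (hsub hxω') with h | h
      · exact Or.inl h
      · exact Or.inr h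
  have hinsG : insert e ω ∉ G := fun h => hG' (((determinedBy_iff _ _).1 hGK _ _ hagree).1 h)
  -- (c) `ω` is maximal outside `B₂` among `K`-patterns, hence `ω ∈ G`
  have hup : ∀ j ∈ K, j ∉ ω → ω ∪ {j} ∈ B₂ := by
    intro j hj hjω
    rcases Finset.mem_insert.1 hj with rfl | hjF
    · have : ω ∪ {j} = insert j ω := by ext x; simp only [Set.mem_union, Set.mem_singleton_iff, Set.mem_insert_iff]; tauto
      rw [this]; exact ⟨ω', hsub, hBs', hG'⟩
    · have hje : j ≠ e := fun h => heF (h ▸ hjF)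
      have h := hB₂dom j hjF (insert e ω) ⟨ω', hsub, hBs', hG'⟩ (Set.mem_insert e ω)
        (fun h => h.elim (fun h => hje h) (fun h => hjω h))
      have heq : (insert e ω \ {e}) ∪ {j} = ω ∪ {j} := by
        ext x
        simp only [Set.mem_union, Set.mem_sdiff, Set.mem_insert_iff, Set.mem_singleton_iff]
        constructor
        · rintro (⟨rfl | hx, hxe⟩ | rfl)
          · exact absurd rfl hxe
          · exact Or.inl hx
          · exact Or.inr rfl
        · rintro (hx | rfl)
          · exact Or.inl ⟨Or.inr hx, fun hxe => heω (hxe ▸ hx)⟩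
          · exact Or.inr rfl
      rw [heq] at h
      exact h
  have hωG : ω ∈ G := by
    by_cases hωBs : ω ∈ Bs
    · by_contra hG
      exact hω ⟨ω, subset_rfl, hωBs, hG⟩
    · have hex : ∃ z : Set ι, ω ⊆ z ∧ z ∈ G ∧ z ∉ B := by
        by_contra h
        push Not at h
        exact hωBs fun z hz hzG => h z hz hzG
      obtain ⟨z, hωz, hzG, hzB⟩ := hex
      have hagree' : ω ∩ (↑K : Set ι) = z ∩ ↑K := by
        ext x
        simp only [Set.mem_inter_iff, Finset.mem_coe]
        constructor
        · rintro ⟨hx, hxK⟩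
          exact ⟨hωz hx, hxK⟩
        · rintro ⟨hxz, hxK⟩
          refine ⟨?_, hxK⟩
          by_contra hxω
          have h1 : ω ∪ {x} ∈ Bs := hB₂Bs (hup x hxK hxω)
          have h2 : z ∈ Bs := hBsup (Set.union_subset hωz (Set.singleton_subset_iff.2 hxz)) h1
          exact hzB (h2 z subset_rfl hzG)
      exact ((determinedBy_iff _ _).1 hGK _ _ hagree').2 hzG
  exact hinsG (hGup (Set.subset_insert e ω) hωG)

end free

/-! ## §5 The package, and the drift of an `e`-free partner -/

/-- **COSTLY-REGION REDUCTION** (memo Lemmas 2–4 packaged).  Slot `Th_{t+1}(insert e S')` with `insert e F ⊆ insert e S'` (`e ∉ S'`, `F ⊆ S'`),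
ANY density vector; `A, B` increasing, `insert e F`-determined, `A` `e`-dominant and `B` `e`-dominated over `F`.  Then there is an increasing
`insert e F`-determined `B₂` NOT DEPENDING ON `e` with `n(A, B₂) ≤ n(A, B)`. [this work] -/
theorem exists_free_reduct (p : ι → unitInterval) {F S' : Finset ι} {e : ι} (heS' : e ∉ S') (hFS' : F ⊆ S') (t : ℕ)
    {A B : Set (Set ι)} (hA : IsUpperSet A) (hB : IsUpperSet B)
    (hAF : DeterminedBy A (↑(insert e F) : Set ι)) (hBF : DeterminedBy B (↑(insert e F) : Set ι))
    (hdomA : ∀ j ∈ F, ∀ ω ∈ A, e ∉ ω → j ∈ ω → (ω \ {j}) ∪ {e} ∈ A)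
    (hdomB : ∀ j ∈ F, ∀ ω ∈ B, e ∈ ω → j ∉ ω → (ω \ {e}) ∪ {j} ∈ B) :
    ∃ B₂ : Set (Set ι), IsUpperSet B₂ ∧ DeterminedBy B₂ (↑(insert e F) : Set ι) ∧
      (∀ ω : Set ι, insert e ω ∈ B₂ ↔ ω \ {e} ∈ B₂) ∧
      osN p {ω : Set ι | t + 1 ≤ ((insert e S').filter (· ∈ ω)).card} (ind A) (ind B₂) ≤
        osN p {ω : Set ι | t + 1 ≤ ((insert e S').filter (· ∈ ω)).card} (ind A) (ind B) := by
  set K : Finset ι := insert e F with hKdef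
  set S : Finset ι := insert e S' with hSdef
  have heF : e ∉ F := fun h => heS' (hFS' h)
  have hKS : K ⊆ S := Finset.insert_subset_insert e hFS'
  -- the costly level `g`
  have hex : ∃ k : ℕ, (prodBernoulli p).real {ω : Set ι | ((S \ K).filter (· ∈ ω)).card + k < t + 1} *
        (prodBernoulli p).real (Aᶜ ∩ {ω : Set ι | (S.filter (· ∈ ω)).card < t + 1}) ≤
      (prodBernoulli p).real {ω : Set ι | (S.filter (· ∈ ω)).card < t + 1} * (1 - (prodBernoulli p).real A) :=
    ⟨t + 1, by
      rw [real_shiftedBall_self, zero_mul]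
      exact mul_nonneg measureReal_nonneg (sub_nonneg.2 measureReal_le_one)⟩
  set g : ℕ := Nat.find hex with hgdef
  have hcost := Nat.find_spec hex
  have hfree : ∀ k < g, (prodBernoulli p).real {ω : Set ι | (S.filter (· ∈ ω)).card < t + 1} * (1 - (prodBernoulli p).real A) ≤
      (prodBernoulli p).real {ω : Set ι | ((S \ K).filter (· ∈ ω)).card + k < t + 1} *
        (prodBernoulli p).real (Aᶜ ∩ {ω : Set ι | (S.filter (· ∈ ω)).card < t + 1}) :=
    fun k hk => le_of_lt (not_le.1 (Nat.find_min hex hk))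
  set G : Set (Set ι) := A ∩ {ω : Set ι | g ≤ (K.filter (· ∈ ω)).card} with hGdef
  set Bs : Set (Set ι) := {ω : Set ι | ∀ ω'' : Set ι, ω ⊆ ω'' → ω'' ∈ G → ω'' ∈ B} with hBsdef
  set B₂ : Set (Set ι) := {ω : Set ι | ∃ ω' : Set ι, ω' ⊆ ω ∧ ω' ∈ Bs ∧ ω' ∉ G} with hB₂def
  have hGK : DeterminedBy G (↑K : Set ι) := determinedBy_costly hAF g
  have hBsup : IsUpperSet Bs := isUpperSet_hgen G B
  have hBsK : DeterminedBy Bs (↑K : Set ι) := determinedBy_hgen hGK hBF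
  have hB₂up : IsUpperSet B₂ := isUpperSet_lift Bs G
  refine ⟨B₂, hB₂up, determinedBy_lift hBsK hGK, fun ω => ⟨fun h => ?_, fun h => ?_⟩, ?_⟩
  · have h' : insert e (ω \ {e}) ∈ B₂ := by rwa [Set.insert_sdiff_singleton]
    exact lift_free heF hA hAF hBF hdomA hdomB g (ω \ {e}) (fun h => h.2 rfl) h'
  · exact hB₂up (Set.sdiff_subset.trans (Set.subset_insert e ω)) h
  · exact (osN_lift_le p hKS (t + 1) hBsup hAF hBsK g hcost).trans (osN_sharp_le p hKS (t + 1) hA hB hAF hBF g hfree)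

/-- **The drift of an `e`-free partner is nonpositive** (ball monotonicity `real_inter_ball_mul_le`, ANY density): for the slot
`H = Th_{t+1}(insert e G)` (`e ∉ G`) and an increasing `insert e G`-determined `B` whose sections at `e` agree,
`U_B = (1−μH⁰)(μB¹ − μ(H¹∩B¹)) − (1−μH¹)(μB⁰ − μ(H⁰∩B⁰)) ≤ 0`. [this work] -/
theorem drift_nonpos_of_free (p : ι → unitInterval) {G : Finset ι} {e : ι} (heG : e ∉ G) (t : ℕ) {B : Set (Set ι)}
    (hB : IsUpperSet B) (hBG : DeterminedBy B (↑(insert e G) : Set ι))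
    (hfree : ∀ ω : Set ι, insert e ω ∈ B ↔ ω \ {e} ∈ B) :
    (1 - (prodBernoulli p).real {ω : Set ι | ω \ {e} ∈ {ω : Set ι | t + 1 ≤ ((insert e G).filter (· ∈ ω)).card}}) *
          ((prodBernoulli p).real {ω : Set ι | insert e ω ∈ B} -
            (prodBernoulli p).real ({ω : Set ι | insert e ω ∈ {ω : Set ι | t + 1 ≤ ((insert e G).filter (· ∈ ω)).card}} ∩
              {ω : Set ι | insert e ω ∈ B}))
        - (1 - (prodBernoulli p).real {ω : Set ι | insert e ω ∈ {ω : Set ι | t + 1 ≤ ((insert e G).filter (· ∈ ω)).card}}) *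
          ((prodBernoulli p).real {ω : Set ι | ω \ {e} ∈ B} -
            (prodBernoulli p).real ({ω : Set ι | ω \ {e} ∈ {ω : Set ι | t + 1 ≤ ((insert e G).filter (· ∈ ω)).card}} ∩
              {ω : Set ι | ω \ {e} ∈ B})) ≤ 0 := by
  rw [section_insert_threshold heG, section_sdiff_threshold heG, one_sub_real_threshold, one_sub_real_threshold,
    real_sub_real_threshold_inter, real_sub_real_threshold_inter]
  have hsec : {ω : Set ι | insert e ω ∈ B} = {ω : Set ι | ω \ {e} ∈ B} := Set.ext fun ω => hfree ω
  have hcoe : (↑(insert e G) : Set ι) \ {e} = ↑G := by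
    ext i
    simp only [Set.mem_sdiff, Finset.coe_insert, Set.mem_insert_iff, Finset.mem_coe, Set.mem_singleton_iff]
    constructor
    · rintro ⟨h | h, hne⟩
      · exact absurd h hne
      · exact h
    · intro h
      exact ⟨Or.inr h, fun hie => heG (hie ▸ h)⟩
  have hB0G : DeterminedBy {ω : Set ι | ω \ {e} ∈ B} (↑G : Set ι) := hcoe ▸ determinedBy_section_sdiff hBG e
  have hB0 : IsUpperSet {ω : Set ι | ω \ {e} ∈ B} := isUpperSet_section_sdiff hB e
  rw [hsec]
  have h := real_inter_ball_mul_le p G hB0 hB0G t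
  linarith


end SahiOneStep

end Summit.CriticalPhenomena.PercolationContinuityZ3.Theorems
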